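import Summits.HodgeConjecture.HodgeConjecture.Theses.LinearSystemTorelli
import Literature.AlgebraicGeometry.HodgeTheory.ComplexConjugationHolds
import Literature.AlgebraicGeometry.HodgeTheory.SupportedClassesHodgeConiveauProofs
import Literature.NumberTheory.Transcendental.DeRhamTheoremMultiplicative

/-!
# Route LinearSystemTorelli — `ConiveauOneOfVanishingGenus` is the missing half of a criterion (stmt-HodgeConjecture-2410)

The support item `ConiveauOneOfVanishingGenus` (stmt-HodgeConjecture-2410) of route
`LinearSystemTorelli` asserts, for `p ≥ 1` and `X` smooth projective of dimension `2p` over `ℂ`: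
`h^{2p,0}(X) = 0 ⟹ N¹ H²ᵖ(X(ℂ); ℂ) = H²ᵖ(X(ℂ); ℂ)` (`supportedClasses X (2p) 1 = ⊤`), i.e.
Grothendieck's generalized Hodge conjecture GHC(2p, 1) for the full middle cohomology.  The
companion file `LinearSystemTorelliConiveauOneOfVanishingGenus` records that the item follows from
the route's crux `TranscendentalOrSupported` and that its instance `p = 1` is Lefschetz `(1,1)`.
This file records the other side of the picture, sorry-free:

* `linearSystemTorelli_coniveauOneOfVanishingGenus_iff_of_hodgeModels` — the Hodge-model
  hypothesis of the item is idle: Hodge models exist for every smooth projective `X`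
  (`nonempty_hodgeModel_holds`, proved in the tree), so the item is equivalent to its model-free
  form (unconditional).
* `linearSystemTorelli_forall_isOfHodgeType_eq_zero_of_supportedClasses_eq_top` — **the converse
  of the item is Grothendieck's "trivial reason"**: if all of `Hᵏ(X(ℂ); ℂ)` is supported in
  codimension `≥ 1` then `X` has no non-zero class of type `(k, 0)` (a holomorphic `k`-form dies on
  no dense Zariski-open set), granted the named fact
  `Grothendieck1969_supportedClasses_le_hodgeConiveau` (`Nˢ Hᵏ ⊆ ⨆_{a,b ≥ s} H^{a,b}`; Grothendieck
  1969 p. 300, Voisin 2014 Thm. 2.39).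
* `linearSystemTorelli_coniveauOneOfVanishingGenus_iff_criterion` — hence, granted that fact, the
  item is EQUIVALENT to the criterion "`N¹ H²ᵖ(X) = H²ᵖ(X) ↔ h^{2p,0}(X) = 0` for every smooth
  projective `X` of dimension `2p`, `p ≥ 1`": the item is exactly the hard (conjectural, GHC)
  half of an `iff` whose easy half is Grothendieck's remark — the statement is sharp, its
  hypothesis cannot be weakened.
* `…_of_deligne` versions — the same with the Grothendieck fact replaced by its only remaining
  undischarged input in the tree, Deligne's *Hodge III* Cor. 8.2.8
  (`Deligne1974_ker_restrictCompl_eq_iSup_range_complexGysin`): Hodge models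
  (`HodgeModels_holds`) and de Rham's theorem (`exists_deRhamIsoFamily_holds`) are proved, and
  `Grothendieck1969_supportedClasses_le_hodgeConiveau_of_deligne` assembles the fact from them.

Status of the item itself (p ≥ 2): open — it is GHC(2p, 1) in the sector `h^{2p,0} = 0`
(Grothendieck 1969, footnote 13; Voisin, *J. Open Math. Probl.* 1 (2025) §4; known when `CH₀(X)`
is supported on a proper closed subset, by the Bloch–Srinivas decomposition of the diagonal, e.g.
for rationally connected `X`).  Nothing here closes it.

References: A. Grothendieck, *Hodge's general conjecture is false for trivial reasons*, Topology 8
(1969) 299–303; C. Voisin, *Chow Rings, Decomposition of the Diagonal, and the Topology of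
Families* (2014), Def. 2.38, Thm. 2.39; P. Deligne, *Théorie de Hodge III* (1974), Cor. 8.2.8;
C. Voisin, *Hodge Theory and Complex Algebraic Geometry II* (2003), Thm. 10.17, Prop. 10.26.
-/

-- `Summit.HodgeConjecture.HodgeConjecture.Theorems` is the mandated namespace (single-conjunct summit:
-- Sub = Summit), which `linter.dupNamespace` flags on every declaration; the lakefile turns the
-- linter off tree-wide (weak option), restated here so stand-alone elaboration is warning-free too.
set_option linter.dupNamespace false

noncomputable section

namespace Summit.HodgeConjecture.HodgeConjecture.Theorems

open Literature.AlgebraicGeometry.HodgeTheory Literature.AlgebraicGeometry.Motives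
open Literature.AlgebraicTopology.SingularHomology

variable {n : ℕ} {X : SchemeOver ℂ}

/-! ### The Hodge-model hypothesis is idle -/

/-- **Model-free form of the item.** Since every smooth projective complex variety has a Hodge
model (`nonempty_hodgeModel_holds`: Serre GAGA §2, de Rham, the Hodge decomposition of the compact
Kähler manifold `X^an` — proved in the tree), the hypothesis `Nonempty (HodgeModel (2p) X)` of
`ConiveauOneOfVanishingGenus` is automatic, and the item is equivalent to: for `p ≥ 1` and `X`
smooth projective of dimension `2p` with no non-zero class of type `(2p, 0)`,
`N¹ H²ᵖ(X(ℂ); ℂ) = ⊤`. [cite: VoisinHodgeI2002, §6.1.3 Prop. 6.11 and §7.1.1] -/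
theorem linearSystemTorelli_coniveauOneOfVanishingGenus_iff_of_hodgeModels :
    Summit.HodgeConjecture.HodgeConjecture.Theses.LinearSystemTorelli.ConiveauOneOfVanishingGenus ↔
      ∀ ⦃p : ℕ⦄ ⦃X : SchemeOver ℂ⦄, 1 ≤ p → IsSmoothProjective (2 * p) X →
        (∀ c : complexBetti X (2 * p), IsOfHodgeType (2 * p) X (2 * p) (2 * p) 0 c → c = 0) →
        supportedClasses X (2 * p) 1 = ⊤ := by
  unfold Summit.HodgeConjecture.HodgeConjecture.Theses.LinearSystemTorelli.ConiveauOneOfVanishingGenus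
  exact ⟨fun h p X hp hX h0 ↦ h hp hX (nonempty_hodgeModel_holds hX) h0,
    fun h p X hp hX _ h0 ↦ h hp hX h0⟩

/-! ### The converse of the item: Grothendieck's trivial reason -/

/-- **If all of `Hᵏ(X(ℂ); ℂ)` is supported in codimension `≥ 1`, then `X` has no non-zero class of
type `(k, 0)`** (granted `Grothendieck1969_supportedClasses_le_hodgeConiveau`): a class supported
on a proper Zariski-closed subset has Hodge coniveau `≥ 1` (Grothendieck 1969, p. 300; Voisin 2014,
Thm. 2.39), and the piece `H^{k,0}` meets the classes of Hodge coniveau `≥ 1` only in `0`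
(independence of the `H^{p,q}`). This is the converse of the support item
`ConiveauOneOfVanishingGenus` (take `k = 2p = dim X`): its hypothesis `h^{2p,0} = 0` is NECESSARY.
[cite: GrothendieckTopology1969, p. 300 and footnote 13] [cite: VoisinChowRings2014, Thm. 2.39] -/
theorem linearSystemTorelli_forall_isOfHodgeType_eq_zero_of_supportedClasses_eq_top
    (h : Grothendieck1969_supportedClasses_le_hodgeConiveau) (hX : IsSmoothProjective n X) {k : ℕ}
    (htop : supportedClasses X k 1 = ⊤) :
    ∀ c : complexBetti X k, IsOfHodgeType n X k k 0 c → c = 0 :=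
  fun _ hc ↦ h.eq_zero_of_isOfHodgeType_zero hX le_rfl (htop ▸ Submodule.mem_top) hc

/-- **The item is the hard half of a criterion.** Granted
`Grothendieck1969_supportedClasses_le_hodgeConiveau`, the support item `ConiveauOneOfVanishingGenus`
is equivalent to: for every `p ≥ 1` and every smooth projective `X` of dimension `2p` over `ℂ`,
`N¹ H²ᵖ(X(ℂ); ℂ) = H²ᵖ(X(ℂ); ℂ)` **iff** `X` has no non-zero class of type `(2p, 0)`. The
direction `→` of the inner `iff` is Grothendieck's remark (previous theorem); the direction `←`
is the item, i.e. GHC(2p, 1) for the full middle cohomology (open for `p ≥ 2`). The Hodge-model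
hypothesis of the item is discharged by `nonempty_hodgeModel_holds`.
[cite: GrothendieckTopology1969, p. 300 and footnote 13] [cite: VoisinChowRings2014, Thm. 2.39] -/
theorem linearSystemTorelli_coniveauOneOfVanishingGenus_iff_criterion
    (h : Grothendieck1969_supportedClasses_le_hodgeConiveau) :
    Summit.HodgeConjecture.HodgeConjecture.Theses.LinearSystemTorelli.ConiveauOneOfVanishingGenus ↔
      ∀ ⦃p : ℕ⦄ ⦃X : SchemeOver ℂ⦄, 1 ≤ p → IsSmoothProjective (2 * p) X →
        (supportedClasses X (2 * p) 1 = ⊤ ↔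
          ∀ c : complexBetti X (2 * p), IsOfHodgeType (2 * p) X (2 * p) (2 * p) 0 c → c = 0) := by
  rw [linearSystemTorelli_coniveauOneOfVanishingGenus_iff_of_hodgeModels]
  exact ⟨fun hC p X hp hX ↦
      ⟨linearSystemTorelli_forall_isOfHodgeType_eq_zero_of_supportedClasses_eq_top h hX,
        hC hp hX⟩,
    fun hC p X hp hX h0 ↦ (hC hp hX).2 h0⟩

/-! ### The same modulo Deligne's Cor. 8.2.8 only -/

/-- **Grothendieck's coniveau fact from Deligne's Cor. 8.2.8 alone.** Of the three inputs of
`Grothendieck1969_supportedClasses_le_hodgeConiveau_of_deligne` — Deligne's *Hodge III* Cor. 8.2.8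
(kernel of restriction = sum of Gysin images of a resolution), the existence of Hodge models, and
de Rham's theorem with products — the last two are theorems of the tree
(`HodgeModels_holds` = `nonempty_hodgeModel_holds`; `exists_deRhamIsoFamily_holds`), so the fact
holds granted Cor. 8.2.8. [cite: DeligneHodgeIII1974, Cor. 8.2.8]
[cite: GrothendieckTopology1969, p. 300] -/
theorem linearSystemTorelli_supportedClasses_le_hodgeConiveau_of_deligne
    (hD : Deligne1974_ker_restrictCompl_eq_iSup_range_complexGysin) :
    Grothendieck1969_supportedClasses_le_hodgeConiveau :=
  Grothendieck1969_supportedClasses_le_hodgeConiveau_of_deligne hD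
    (fun m Y ↦ Summit.HodgeConjecture.HodgeConjecture.Theses.LinearSystemTorelli.HodgeModels_holds m Y)
    (fun E _ _ _ ↦ Literature.NumberTheory.Transcendental.exists_deRhamIsoFamily_holds E)

/-- The converse of the item granted Deligne's Cor. 8.2.8 only: `N¹ Hᵏ(X(ℂ); ℂ) = ⊤` forces the
vanishing of every class of type `(k, 0)`. [cite: DeligneHodgeIII1974, Cor. 8.2.8]
[cite: GrothendieckTopology1969, p. 300 and footnote 13] -/
theorem linearSystemTorelli_forall_isOfHodgeType_eq_zero_of_supportedClasses_eq_top_of_deligne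
    (hD : Deligne1974_ker_restrictCompl_eq_iSup_range_complexGysin) (hX : IsSmoothProjective n X)
    {k : ℕ} (htop : supportedClasses X k 1 = ⊤) :
    ∀ c : complexBetti X k, IsOfHodgeType n X k k 0 c → c = 0 :=
  linearSystemTorelli_forall_isOfHodgeType_eq_zero_of_supportedClasses_eq_top
    (linearSystemTorelli_supportedClasses_le_hodgeConiveau_of_deligne hD) hX htop

/-- The criterion form of the item granted Deligne's Cor. 8.2.8 only:
`ConiveauOneOfVanishingGenus ↔ ∀ p ≥ 1, ∀ X^{2p} smooth projective, (N¹ H²ᵖ = ⊤ ↔ h^{2p,0} = 0)`.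
[cite: DeligneHodgeIII1974, Cor. 8.2.8] [cite: GrothendieckTopology1969, p. 300 and footnote 13] -/
theorem linearSystemTorelli_coniveauOneOfVanishingGenus_iff_criterion_of_deligne
    (hD : Deligne1974_ker_restrictCompl_eq_iSup_range_complexGysin) :
    Summit.HodgeConjecture.HodgeConjecture.Theses.LinearSystemTorelli.ConiveauOneOfVanishingGenus ↔
      ∀ ⦃p : ℕ⦄ ⦃X : SchemeOver ℂ⦄, 1 ≤ p → IsSmoothProjective (2 * p) X →
        (supportedClasses X (2 * p) 1 = ⊤ ↔
          ∀ c : complexBetti X (2 * p), IsOfHodgeType (2 * p) X (2 * p) (2 * p) 0 c → c = 0) :=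
  linearSystemTorelli_coniveauOneOfVanishingGenus_iff_criterion
    (linearSystemTorelli_supportedClasses_le_hodgeConiveau_of_deligne hD)

end Summit.HodgeConjecture.HodgeConjecture.Theorems

end
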